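import Literature.NumberTheory.Sieve.McCurleyCoveringEstimates
import Literature.NumberTheory.LFunctions.MertensFormula
import HarnessLib

/-!
# Estimates for McCurley's covering theorem, II: the rough part and the small-prime bound `y`

Topic `Literature/NumberTheory/Sieve`. Everything in this file is PROVED. Continuation of
`McCurleyCoveringEstimates.lean` (notation as there: `L = log w`, `T = log L`, `z = ⌊w/4⌋`,
`F = (w/T)(L log T/T)^d`, `ℓ = L log T/((d+8) T)`, `y = ⌊e^ℓ⌋`), for the proof of Theorem 3 of
K. S. McCurley, *The smallest prime value of `xⁿ + a`*, Can. J. Math. 38 (1986), §4.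

* `McCurley.sum_sdiff_primesLE_inv_le` — `∑_{z<p≤u} 1/p ≤ log₂ u − log₂ z + 16/log z`
  (the tree's Mertens theorem with rate, `Literature.NumberTheory.LFunctions.Mertens.abs_primeRecipSum_sub_le`;
  McCurley's Lemma 1);
* `McCurley.card_rough_le` — `#{1 ≤ m ≤ u : m has a prime factor > z} ≤ u (2d + 2) T/L` for
  `z < u ≤ F` — McCurley's `S₂ ≤ u ∑_{z<p≤u} 1/p < (1 + ε) d(n) u log₂ w/log w`;
* `McCurley.y_bounds` — `2 ≤ y`, `ℓ/2 ≤ log y`, `y ≤ e^ℓ`, `2 y ≤ z`.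

## References

* K. S. McCurley, Can. J. Math. 38 (1986) 925–936, Lemma 1 (p. 928) and §4 (p. 933).
  [McCurley1986SmallestPrimeValue]
-/

open Finset Filter Real

namespace Literature.NumberTheory.Sieve.McCurley

/-! ### The rough part (`S₂`) -/

/-- `∑_{z < p ≤ u} 1/p ≤ log log u − log log z + 16/log z` for integers `2 ≤ z ≤ u` (the tree's
Mertens theorem with rate, `|∑_{p ≤ x} 1/p − log log x − B₁| ≤ 8/log x`; McCurley's Lemma 1).
[cite: McCurley1986SmallestPrimeValue, Lemma 1 (p. 928)] -/
theorem sum_sdiff_primesLE_inv_le {z u : ℕ} (hz : 2 ≤ z) (hzu : z ≤ u) :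
    ∑ p ∈ Nat.primesLE u \ Nat.primesLE z, (p : ℝ)⁻¹ ≤
      Real.log (Real.log u) - Real.log (Real.log z) + 16 / Real.log z := by
  have hz' : (2 : ℝ) ≤ z := by exact_mod_cast hz
  have hu' : (2 : ℝ) ≤ u := by exact_mod_cast hz.trans hzu
  have hzu' : (z : ℝ) ≤ u := by exact_mod_cast hzu
  have hsub : Nat.primesLE z ⊆ Nat.primesLE u := Nat.primesLE_mono hzu
  have hsd : ∑ p ∈ Nat.primesLE u \ Nat.primesLE z, (p : ℝ)⁻¹ =
      Literature.NumberTheory.LFunctions.Mertens.primeRecipSum u -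
        Literature.NumberTheory.LFunctions.Mertens.primeRecipSum z := by
    rw [Literature.NumberTheory.LFunctions.Mertens.primeRecipSum,
      Literature.NumberTheory.LFunctions.Mertens.primeRecipSum, Nat.floor_natCast,
      Nat.floor_natCast, eq_sub_iff_add_eq, sum_sdiff hsub]
  have hu := Literature.NumberTheory.LFunctions.Mertens.abs_primeRecipSum_sub_le hu'
  have hzM := Literature.NumberTheory.LFunctions.Mertens.abs_primeRecipSum_sub_le hz'
  rw [abs_le] at hu hzM
  have hlogz : 0 < Real.log z := Real.log_pos (by linarith)
  have hlogu : Real.log z ≤ Real.log u := Real.log_le_log (by linarith) hzu'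
  have h8 : 8 / Real.log u ≤ 8 / Real.log z := div_le_div_of_nonneg_left (by norm_num) hlogz hlogu
  rw [hsd]
  have : (16 : ℝ) / Real.log z = 8 / Real.log z + 8 / Real.log z := by ring
  linarith [hu.2, hzM.1]

/-- `w/8 ≤ ⌊w/4⌋` for `w ≥ 8` (naturals). [folklore] -/
theorem cast_div_four_ge {w : ℕ} (hw : 8 ≤ w) : (w : ℝ) / 8 ≤ ((w / 4 : ℕ) : ℝ) := by
  have h1 : w ≤ 8 * (w / 4) := by omega
  have h2 : (w : ℝ) ≤ 8 * ((w / 4 : ℕ) : ℝ) := by exact_mod_cast h1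
  linarith

/-- **The rough part.** With `L = log w`, `T = log L ≥ 19`, `z = ⌊w/4⌋` and an integer `u` with
`z < u ≤ F`, `log F ≤ L + d T`: the integers `1 ≤ m ≤ u` having a prime factor `> z` number at
most `u (2d + 2) T/L` (McCurley: `S₂ ≤ u ∑_{z<p≤u} 1/p < (1 + ε) d(n) u log₂ w/log w`).
[cite: McCurley1986SmallestPrimeValue, §4 (p. 933)] -/
theorem card_rough_le {d : ℕ} {w u : ℕ} {L T F : ℝ} (hL : L = Real.log w) (hT : T = Real.log L)
    (hT19 : 19 ≤ T) (hzu : w / 4 < u) (huF : (u : ℝ) ≤ F) (hF : Real.log F ≤ L + d * T) :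
    (#(Nat.roughNumbersUpTo u (w / 4 + 1)) : ℝ) ≤ u * ((2 * d + 2) * T / L) := by
  obtain ⟨hT0, hlogT1, hlogTT, hexpT, hL200, hexpL, hw200⟩ := basics hL hT hT19
  set z : ℕ := w / 4 with hz
  have hw8 : 8 ≤ w := by exact_mod_cast (show (8 : ℝ) ≤ w by linarith)
  have hz8 : (w : ℝ) / 8 ≤ z := cast_div_four_ge hw8
  have hz2r : (2 : ℝ) ≤ z := by linarith
  have hz2 : 2 ≤ z := by exact_mod_cast hz2r
  have hzu' : z ≤ u := hzu.le
  have hu0 : (0 : ℝ) < u := by exact_mod_cast (show 0 < u by omega)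
  have hw0 : (0 : ℝ) < w := by linarith
  -- `log z ≥ L - log 8 ≥ L/2`
  have hlog8 : Real.log 8 ≤ 3 := by
    have h8 : Real.log 8 = 3 * Real.log 2 := by
      rw [show (8 : ℝ) = 2 ^ 3 by norm_num, Real.log_pow]; ring
    have := Real.log_two_lt_d9
    rw [h8]; linarith
  have hlogz : L - 3 ≤ Real.log z := by
    have : Real.log ((w : ℝ) / 8) ≤ Real.log z := Real.log_le_log (by positivity) hz8
    rw [Real.log_div hw0.ne' (by norm_num), ← hL] at this
    linarith
  have hlogz0 : 0 < Real.log z := by linarith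
  have hlogz2 : L / 2 ≤ Real.log z := by linarith
  have hL0 : 0 < L := by linarith
  -- `log u ≤ L + d T`
  have hlogu : Real.log u ≤ L + d * T :=
    (Real.log_le_log hu0 huF).trans hF
  have hloguz : Real.log z ≤ Real.log u := Real.log_le_log (by linarith) (by exact_mod_cast hzu')
  -- Mathlib: rough numbers are counted by `∑_{z < p ≤ u} ⌊u/p⌋`
  have h1 := Nat.roughNumbersUpTo_card_le u (z + 1)
  have h2 : (#(Nat.roughNumbersUpTo u (z + 1)) : ℝ) ≤
      ∑ p ∈ Nat.primesLE u \ Nat.primesLE z, (u : ℝ) / p := by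
    have : ((∑ p ∈ (u + 1).primesBelow \ (z + 1).primesBelow, u / p : ℕ) : ℝ) ≤
        ∑ p ∈ Nat.primesLE u \ Nat.primesLE z, (u : ℝ) / p := by
      rw [Nat.cast_sum]
      exact sum_le_sum fun p _ => Nat.cast_div_le
    exact le_trans (by exact_mod_cast h1) this
  have h3 : ∑ p ∈ Nat.primesLE u \ Nat.primesLE z, (u : ℝ) / p =
      u * ∑ p ∈ Nat.primesLE u \ Nat.primesLE z, (p : ℝ)⁻¹ := by
    rw [mul_sum]
    exact sum_congr rfl fun p _ => by rw [div_eq_mul_inv]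
  have h4 := sum_sdiff_primesLE_inv_le hz2 hzu'
  -- `log log u - log log z ≤ (log u - log z)/log z`
  have h5 : Real.log (Real.log u) - Real.log (Real.log z) ≤ (Real.log u - Real.log z) / Real.log z := by
    rw [← Real.log_div (by linarith) hlogz0.ne', sub_div, div_self hlogz0.ne']
    exact Real.log_le_sub_one_of_pos (div_pos (by linarith) hlogz0)
  have h6 : (Real.log u - Real.log z) / Real.log z + 16 / Real.log z ≤ (2 * d + 2) * T / L := by
    rw [← add_div, div_le_div_iff₀ hlogz0 hL0]
    have hd0 : (0 : ℝ) ≤ d := Nat.cast_nonneg d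
    have hnum : Real.log u - Real.log z + 16 ≤ d * T + 19 := by linarith
    have hnum0 : 0 ≤ Real.log u - Real.log z + 16 := by linarith
    calc (Real.log u - Real.log z + 16) * L ≤ (d * T + 19) * L :=
          mul_le_mul_of_nonneg_right hnum hL0.le
      _ = (2 * d * T + 38) * (L / 2) := by ring
      _ ≤ ((2 * d + 2) * T) * (L / 2) := by
          refine mul_le_mul_of_nonneg_right ?_ (by linarith)
          linarith
      _ ≤ (2 * d + 2) * T * Real.log z :=
          mul_le_mul_of_nonneg_left hlogz2 (by positivity)
  rw [hz] at h2 h3 h4 h5 h6 hloguz hlogz0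
  rw [h3] at h2
  refine h2.trans (mul_le_mul_of_nonneg_left ?_ hu0.le)
  linarith

/-! ### The small-prime bound `y = ⌊e^ℓ⌋` -/

/-- **The size of `y = ⌊e^ℓ⌋`.** If `2 ≤ ℓ ≤ L/9` and `200 ≤ L = log w` then `2 ≤ y`,
`ℓ/2 ≤ log y`, `(y : ℝ) ≤ e^ℓ` and `2 y ≤ ⌊w/4⌋`. [folklore] -/
theorem y_bounds {w : ℕ} {L ℓ : ℝ} (hL : L = Real.log w) (hL200 : 200 ≤ L) (hℓ2 : 2 ≤ ℓ)
    (hℓL : ℓ ≤ L / 9) :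
    2 ≤ ⌊Real.exp ℓ⌋₊ ∧ ℓ / 2 ≤ Real.log (⌊Real.exp ℓ⌋₊ : ℕ) ∧
      ((⌊Real.exp ℓ⌋₊ : ℕ) : ℝ) ≤ Real.exp ℓ ∧ 2 * ⌊Real.exp ℓ⌋₊ ≤ w / 4 := by
  set y : ℕ := ⌊Real.exp ℓ⌋₊ with hy
  have he := Real.exp_one_gt_d9
  have hexp0 : 0 < Real.exp ℓ := Real.exp_pos ℓ
  have hyle : (y : ℝ) ≤ Real.exp ℓ := Nat.floor_le hexp0.le
  have hyge : Real.exp ℓ - 1 ≤ y := by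
    have := Nat.lt_floor_add_one (Real.exp ℓ)
    rw [← hy] at this; linarith
  -- `exp ℓ ≥ exp 2 ≥ 7.3`
  have hexp2 : (7 : ℝ) ≤ Real.exp ℓ := by
    calc (7 : ℝ) ≤ Real.exp 1 * Real.exp 1 := by nlinarith
      _ = Real.exp 2 := by rw [← Real.exp_add]; norm_num
      _ ≤ Real.exp ℓ := Real.exp_le_exp.2 hℓ2
  have hy2r : (2 : ℝ) ≤ y := by linarith
  have hy2 : 2 ≤ y := by exact_mod_cast hy2r
  -- `log y ≥ log (exp ℓ / 2) = ℓ - log 2 ≥ ℓ/2`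
  have hlog2 := Real.log_two_lt_d9
  have hlogy : ℓ / 2 ≤ Real.log y := by
    have h1 : Real.exp ℓ / 2 ≤ y := by linarith
    have h2 : Real.log (Real.exp ℓ / 2) ≤ Real.log y := Real.log_le_log (by positivity) h1
    rw [Real.log_div hexp0.ne' (by norm_num), Real.log_exp] at h2
    linarith
  refine ⟨hy2, hlogy, hyle, ?_⟩
  -- `2 y ≤ 2 exp (L/9) ≤ w/8 ≤ ⌊w/4⌋`
  have hw0 : (0 : ℝ) < w := by
    by_contra h
    push Not at h
    have : L ≤ 0 := by
      rw [hL]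
      rcases eq_or_lt_of_le h with h' | h'
      · rw [h', Real.log_zero]
      · linarith [(Nat.cast_nonneg w : (0 : ℝ) ≤ w)]
    linarith
  have hexpL : Real.exp L = w := by rw [hL, Real.exp_log hw0]
  have hw8r : (8 : ℝ) ≤ w := by
    rw [← hexpL]
    have := Real.quadratic_le_exp_of_nonneg (by linarith : (0 : ℝ) ≤ L)
    nlinarith
  have hw8 : 8 ≤ w := by exact_mod_cast hw8r
  have hz : (w : ℝ) / 8 ≤ ((w / 4 : ℕ) : ℝ) := cast_div_four_ge hw8
  -- `16 exp (L/9) ≤ exp L`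
  have hkey : 16 * Real.exp (L / 9) ≤ Real.exp L := by
    have h1 : Real.exp L = Real.exp (L / 9) * Real.exp (8 * L / 9) := by
      rw [← Real.exp_add]; ring_nf
    have h2 : (16 : ℝ) ≤ Real.exp (8 * L / 9) := by
      have := Real.quadratic_le_exp_of_nonneg (by linarith : (0 : ℝ) ≤ 8 * L / 9)
      nlinarith
    rw [h1]
    nlinarith [Real.exp_pos (L / 9)]
  have h2y : 2 * (y : ℝ) ≤ ((w / 4 : ℕ) : ℝ) := by
    calc 2 * (y : ℝ) ≤ 2 * Real.exp ℓ := by linarith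
      _ ≤ 2 * Real.exp (L / 9) := by
          have := Real.exp_le_exp.2 hℓL; linarith
      _ ≤ (w : ℝ) / 8 := by rw [← hexpL]; linarith
      _ ≤ ((w / 4 : ℕ) : ℝ) := hz
  exact_mod_cast h2y

end Literature.NumberTheory.Sieve.McCurley
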